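import Mathlib.ModelTheory.Syntax
import Mathlib.ModelTheory.Semantics
import Mathlib.ModelTheory.Complexity
import Mathlib.ModelTheory.Order
import Literature.Computability.Complexity.CNF
import Literature.Computability.MetaComplexity.BoundedArithSyntax
import HarnessLib

/-!
# The Paris–Wilkie propositional translation `⟨φ⟩` of bounded formulas

Trunk: CplxMeta (`Literature/Computability/MetaComplexity`), definition request
`parisWilkieTranslation` (route PneNP/proofcplx: bounded-arithmetic ↔ propositional-proof
transfer).

## Content

* `PropForm.conjs`, `PropForm.disjs`, `PropForm.impl`: big conjunction / disjunction of a list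
  and material implication on G01's `PropForm` (dot-extensions of `Literature.Computability.Complexity.PropForm`;
  `CNF.lean`/`Frege.lean` have none, verified by grep), with their `eval` lemmas.
* `Delta0Formula L α n`: bounded (`Δ₀`) formulas of an ordered first-order language `L` with the
  bounded quantifiers `(∀ x ≤ t)`, `(∃ x ≤ t)` as *primitive* constructors, `n` de Bruijn-bound
  variables and free variables `α` (exactly Mathlib's `BoundedFormula` conventions), together with
  `Delta0Formula.toBoundedFormula` (interpreting `ball`/`bex` by `ballLE`/`bexLE` of
  `BoundedArithSyntax.lean`), its semantics `Delta0Formula.Realize` and the agreement lemma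
  `realize_toBoundedFormula`. For Buss's language, `toBoundedFormula` lands in `IsBounded`
  (`isBounded_toBoundedFormula`) and every `IsBounded` formula arises this way
  (`IsBounded.exists_toBoundedFormula_eq`): `Delta0Formula` is the `Type`-valued reflection of the
  `Prop`-valued class `IsBounded`, which is what a translation defined *by recursion on bounded
  formulas* needs (one cannot recurse into data along the proof of `IsBounded φ`, and Mathlib's
  primitive `∀'` has no Paris–Wilkie translation).
* `Delta0Formula.parisWilkie atom φ v xs : PropForm ℕ`: the Paris–Wilkie translation
  `⟨φ⟩_(v, xs)` (Paris–Wilkie 1985; Krajíček 1995, Def. 9.1.1): first-order variables are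
  replaced by the numerals `v, xs` and terms are *evaluated* in `ℕ`; an equation `s = t` becomes
  the truth constant of `val s = val t`; an atom `R(t̄)` becomes `atom R (val t̄)` — for the
  symbols of the ground language the truth constant of `R(val t̄)` (`PWAtom.ofDecidable`,
  `bussAtom` for Buss's `≤`), for an undetermined ("oracle") predicate symbol a propositional
  variable (`PWAtom.oracle`) —; `¬, ∧, ∨` (here: `⊥`, `→`) commute; and
  `⟨(∀ x ≤ t) ψ⟩ = ⋀_{m ≤ val t} ⟨ψ⟩_(…, m)`, `⟨(∃ x ≤ t) ψ⟩ = ⋁_{m ≤ val t} ⟨ψ⟩_(…, m)`.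
* Semantics: `eval_parisWilkie` (`⟨φ⟩` is true under `σ` iff `φ` holds in `ℕ` with the oracle
  symbols interpreted via `σ`), and for Buss's language `isTautology_parisWilkie_iff`
  (`⟨φ⟩_(n̄)` is a tautology iff `ℕ ⊨ φ(n̄)`; there the translation is variable-free).

## What this is NOT (scope note for the requester)

This is the *value* (unary) translation of Paris–Wilkie / Krajíček §9.1, whose size is polynomial
in the numerical parameters `n̄` and which links `IΔ₀(R)`, `T₂ⁱ(R)` to constant-depth Frege
(Paris–Wilkie 1985; Krajíček 1995, Thm. 9.1.3). It is *not* Cook's / Buss's *binary* translation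
`‖φ‖ⁿ` (Cook 1975; Krajíček 1995, Def. 9.2.1), in which a number of bit-length `n` becomes `n`
atoms and atomic formulas become polynomial-size formulas computing the bits of `+, ·, #, |·|`;
that translation (needed for `S₂¹ ⊢ ∀x φ ⇒` polynomial-size `EF` proofs, Cook 1975 / Buss 1986 /
Krajíček 1995 Thm. 9.2.5) requires explicit `NC¹` arithmetic formulas and should be a separate
definition item (`cookTranslation`). On the unrelativized language `Language.boundedArith` the
Paris–Wilkie translation is variable-free (its tautologyhood is just truth in `ℕ`); the intended
non-trivial use is with `atom := PWAtom.oracle …` on a language extended by an undetermined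
predicate, or `PWAtom.sum` of the two.

## Sources

* J. Paris, A. Wilkie, *Counting problems in bounded arithmetic*, in: Methods in Mathematical
  Logic (Caracas 1983), LNM 1130, Springer 1985, 317–340 (§1: the translation).
* J. Krajíček, *Bounded Arithmetic, Propositional Logic, and Complexity Theory*, CUP 1995,
  §9.1, Def. 9.1.1 (the translation `⟨θ⟩_(ñ)`), Thm. 9.1.3; §9.2 (the binary translation).

## Design choices

* Generic over an ordered language `L` with `[L.Structure ℕ]` and an explicit atom translation
  `atom : PWAtom L` rather than fixed to Buss's language, so that the same definition serves
  `L_PA(R)`, `L(α)` etc. once such languages are set up; no new instances are declared.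
* Connective basis: `Delta0Formula` follows Mathlib (`⊥`, `→` primitive; `¬, ∧, ∨, ↔` derived),
  and `→` is translated as `¬a ∨ b` (`PropForm.impl`); `⋀`/`⋁` are right-nested binary
  `conj`/`disj` ending in `⊤`/`⊥` (`PropForm.conjs`/`disjs`), the basis of `PropForm` being
  binary.
-/

universe u v

namespace Literature.Computability.Complexity.PropForm

variable {ν : Type u}

/-- Big conjunction `⋀ l` of a list of formulas (right-nested, `⋀ [] = ⊤`). [folklore] -/
def conjs : List (PropForm ν) → PropForm ν
  | [] => const true
  | φ :: l => conj φ (conjs l)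

/-- Big disjunction `⋁ l` of a list of formulas (right-nested, `⋁ [] = ⊥`). [folklore] -/
def disjs : List (PropForm ν) → PropForm ν
  | [] => const false
  | φ :: l => disj φ (disjs l)

/-- Material implication `φ → ψ := ¬φ ∨ ψ` on `PropForm`. [folklore] -/
def impl (φ ψ : PropForm ν) : PropForm ν :=
  disj (neg φ) ψ

/-- `⋀ l` is true iff every member of `l` is true. [folklore] -/
@[simp] theorem eval_conjs (σ : ν → Bool) (l : List (PropForm ν)) :
    (conjs l).eval σ = true ↔ ∀ φ ∈ l, φ.eval σ = true := by
  induction l with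
  | nil => simp [conjs, eval]
  | cons φ l ih => simp [conjs, eval, ih]

/-- `⋁ l` is true iff some member of `l` is true. [folklore] -/
@[simp] theorem eval_disjs (σ : ν → Bool) (l : List (PropForm ν)) :
    (disjs l).eval σ = true ↔ ∃ φ ∈ l, φ.eval σ = true := by
  induction l with
  | nil => simp [disjs, eval]
  | cons φ l ih => simp [disjs, eval, ih]

/-- Truth table of `impl`. [folklore] -/
@[simp] theorem eval_impl (σ : ν → Bool) (φ ψ : PropForm ν) :
    (impl φ ψ).eval σ = true ↔ (φ.eval σ = true → ψ.eval σ = true) := by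
  simp only [impl, eval, Bool.or_eq_true, Bool.not_eq_true']
  cases φ.eval σ <;> simp

/-- `⋀ l` has size `1 + ∑ (size φ + 1)`. [folklore] -/
theorem size_conjs (l : List (PropForm ν)) :
    (conjs l).size = (l.map fun φ => φ.size + 1).sum + 1 := by
  induction l with
  | nil => simp [conjs, size]
  | cons φ l ih => simp [conjs, size, ih]; omega

/-- `⋁ l` has size `1 + ∑ (size φ + 1)`. [folklore] -/
theorem size_disjs (l : List (PropForm ν)) :
    (disjs l).size = (l.map fun φ => φ.size + 1).sum + 1 := by
  induction l with
  | nil => simp [disjs, size]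
  | cons φ l ih => simp [disjs, size, ih]; omega

end Literature.Computability.Complexity.PropForm

namespace Literature.Computability.MetaComplexity

open FirstOrder FirstOrder.Language FirstOrder.Language.Structure Complexity

/-! ## Bounded formulas with primitive bounded quantifiers -/

/-- `Delta0Formula L α n`: the bounded (`Δ₀`) formulas of an ordered language `L` with free
variables from `α` and `n` de Bruijn-bound variables, generated from `⊥`, equations, relational
atoms by `→` and the *bounded* quantifiers `(∀ x ≤ t) φ`, `(∃ x ≤ t) φ` where the bound `t` is
a term in the outer context (Buss 1986, §2.1; Krajíček 1995, §5.2 / Def. 9.1.1). This is the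
`Type`-valued counterpart of the class `IsBounded` on Mathlib's `BoundedFormula`
(`toBoundedFormula`, `IsBounded.exists_toBoundedFormula_eq`), needed to define translations by
recursion on bounded formulas. [cite: Krajicek1995, Def. 9.1.1] -/
inductive Delta0Formula (L : FirstOrder.Language.{u, v}) [L.IsOrdered] (α : Type) :
    ℕ → Type (max u v)
  /-- falsum `⊥` -/
  | falsum {n : ℕ} : Delta0Formula L α n
  /-- the equation `t₁ = t₂` -/
  | equal {n : ℕ} (t₁ t₂ : L.Term (α ⊕ Fin n)) : Delta0Formula L α n
  /-- the relational atom `R(t̄)` -/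
  | rel {n l : ℕ} (R : L.Relations l) (ts : Fin l → L.Term (α ⊕ Fin n)) : Delta0Formula L α n
  /-- implication -/
  | imp {n : ℕ} (φ ψ : Delta0Formula L α n) : Delta0Formula L α n
  /-- the bounded universal quantifier `(∀ xₙ ≤ t) φ` -/
  | ball {n : ℕ} (t : L.Term (α ⊕ Fin n)) (φ : Delta0Formula L α (n + 1)) : Delta0Formula L α n
  /-- the bounded existential quantifier `(∃ xₙ ≤ t) φ` -/
  | bex {n : ℕ} (t : L.Term (α ⊕ Fin n)) (φ : Delta0Formula L α (n + 1)) : Delta0Formula L α n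

namespace Delta0Formula

variable {L : FirstOrder.Language.{u, v}} [L.IsOrdered] {α : Type} {n : ℕ}

/-- Negation `¬φ := φ → ⊥` of a bounded formula. [folklore] -/
protected def not (φ : Delta0Formula L α n) : Delta0Formula L α n :=
  φ.imp falsum

/-- The bounded formula denoted by a `Delta0Formula`, as a Mathlib `BoundedFormula`:
`ball t φ ↦ ballLE t φ = ∀' (xₙ ≤ t ⟹ φ)`, `bex t φ ↦ bexLE t φ = ∃' (xₙ ≤ t ⊓ φ)`
(Buss 1986, §1.1). [cite: Buss1986, §1.1] -/
def toBoundedFormula : ∀ {n : ℕ}, Delta0Formula L α n → L.BoundedFormula α n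
  | _, falsum => ⊥
  | _, equal t₁ t₂ => Term.bdEqual t₁ t₂
  | _, rel R ts => R.boundedFormula ts
  | _, imp φ ψ => φ.toBoundedFormula ⟹ ψ.toBoundedFormula
  | _, ball t φ => ballLE t φ.toBoundedFormula
  | _, bex t φ => bexLE t φ.toBoundedFormula

section Semantics

variable {M : Type} [L.Structure M] [LE M]

/-- Tarski semantics of bounded formulas in an ordered structure `M`: the bounded quantifiers
range over `{a | a ≤ val t}` (Buss 1986, §1.1). [cite: Buss1986, §1.1] -/
def Realize : ∀ {n : ℕ}, Delta0Formula L α n → (α → M) → (Fin n → M) → Prop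
  | _, falsum, _, _ => False
  | _, equal t₁ t₂, v, xs => t₁.realize (Sum.elim v xs) = t₂.realize (Sum.elim v xs)
  | _, rel R ts, v, xs => RelMap R fun i => (ts i).realize (Sum.elim v xs)
  | _, imp φ ψ, v, xs => φ.Realize v xs → ψ.Realize v xs
  | _, ball t φ, v, xs => ∀ a ≤ t.realize (Sum.elim v xs), φ.Realize v (Fin.snoc xs a)
  | _, bex t φ, v, xs => ∃ a ≤ t.realize (Sum.elim v xs), φ.Realize v (Fin.snoc xs a)

variable [L.OrderedStructure M]

/-- `toBoundedFormula` is meaning-preserving: in an ordered structure a `Delta0Formula` and its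
`BoundedFormula` have the same truth value (Buss 1986, §1.1). [cite: Buss1986, §1.1] -/
@[simp] theorem realize_toBoundedFormula (φ : Delta0Formula L α n) (v : α → M) (xs : Fin n → M) :
    φ.toBoundedFormula.Realize v xs ↔ φ.Realize v xs := by
  induction φ with
  | falsum => simp [toBoundedFormula, Realize]
  | equal t₁ t₂ => simp [toBoundedFormula, Realize]
  | rel R ts => simp [toBoundedFormula, Realize]
  | imp φ ψ ihφ ihψ => simp [toBoundedFormula, Realize, ihφ, ihψ]
  | ball t φ ih => simp [toBoundedFormula, Realize, ih]
  | bex t φ ih => simp [toBoundedFormula, Realize, ih]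

end Semantics

/-- For Buss's language, `toBoundedFormula φ` is a bounded formula in the sense of `IsBounded`
(Buss 1986, §2.1). [cite: Buss1986, §2.1] -/
theorem isBounded_toBoundedFormula {α : Type} :
    ∀ {n : ℕ} (φ : Delta0Formula Language.boundedArith α n), IsBounded φ.toBoundedFormula
  | _, falsum => .of_isQF .falsum
  | _, equal t₁ t₂ => .of_isQF (.of_isAtomic (.equal t₁ t₂))
  | _, rel R ts => .of_isQF (.of_isAtomic (.rel R ts))
  | _, imp φ ψ => .imp (isBounded_toBoundedFormula φ) (isBounded_toBoundedFormula ψ)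
  | _, ball t φ => .ballLE t (isBounded_toBoundedFormula φ)
  | _, bex t φ => .bexLE t (isBounded_toBoundedFormula φ)

/-- Conversely every `IsBounded` formula of Buss's language is the image of a `Delta0Formula`
(Buss 1986, §2.1). [cite: Buss1986, §2.1] -/
theorem _root_.Literature.Computability.MetaComplexity.IsBounded.exists_toBoundedFormula_eq {α : Type} {n : ℕ}
    {φ : Language.boundedArith.BoundedFormula α n} (h : IsBounded φ) :
    ∃ ψ : Delta0Formula Language.boundedArith α n, ψ.toBoundedFormula = φ := by
  induction h with
  | of_isQF hqf =>
    induction hqf with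
    | falsum => exact ⟨.falsum, rfl⟩
    | of_isAtomic hat =>
      cases hat with
      | equal t₁ t₂ => exact ⟨.equal t₁ t₂, rfl⟩
      | rel R ts => exact ⟨.rel R ts, rfl⟩
    | imp _ _ ih₁ ih₂ =>
      obtain ⟨a, rfl⟩ := ih₁
      obtain ⟨b, rfl⟩ := ih₂
      exact ⟨.imp a b, rfl⟩
  | imp _ _ ih₁ ih₂ =>
    obtain ⟨a, rfl⟩ := ih₁
    obtain ⟨b, rfl⟩ := ih₂
    exact ⟨.imp a b, rfl⟩
  | ballLE t _ ih =>
    obtain ⟨a, rfl⟩ := ih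
    exact ⟨.ball t a, rfl⟩
  | bexLE t _ ih =>
    obtain ⟨a, rfl⟩ := ih
    exact ⟨.bex t a, rfl⟩

end Delta0Formula

/-! ## The translation -/

/-- `PWAtom L`: how the Paris–Wilkie translation renders a relational atom `R(m̄)` whose
arguments have already been evaluated to numbers `m̄`: as a propositional formula over the
variables `ℕ`. Symbols of the ground language are rendered by their truth value
(`PWAtom.ofDecidable`, `bussAtom`), undetermined predicate symbols by propositional variables
(`PWAtom.oracle`) (Krajíček 1995, Def. 9.1.1 (a)). [cite: Krajicek1995, Def. 9.1.1] -/
def PWAtom (L : FirstOrder.Language.{u, v}) : Type v :=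
  ∀ ⦃l : ℕ⦄, L.Relations l → (Fin l → ℕ) → PropForm ℕ

namespace PWAtom

variable {L : FirstOrder.Language.{u, v}}

/-- Ground-language atoms: `R(m̄)` is rendered by the truth constant of `R(m̄)` in `ℕ`
(Krajíček 1995, Def. 9.1.1 (a), first clause). [cite: Krajicek1995, Def. 9.1.1] -/
def ofDecidable [L.Structure ℕ] (dec : ∀ ⦃l : ℕ⦄ (R : L.Relations l) (w : Fin l → ℕ),
    Decidable (RelMap R w)) : PWAtom L :=
  fun _ R w => PropForm.const (@decide (RelMap R w) (dec R w))

/-- Oracle atoms: `R(m̄)` is rendered by the propositional variable `code R m̄`, for an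
injective coding `code` of atoms by natural numbers (Krajíček 1995, Def. 9.1.1 (a), second
clause: `⟨R(t)⟩ = p_{val t}`). [cite: Krajicek1995, Def. 9.1.1] -/
def oracle (code : ∀ ⦃l : ℕ⦄, L.Relations l → (Fin l → ℕ) → ℕ) : PWAtom L :=
  fun _ R w => PropForm.var (code R w)

/-- Atom translation for a sum language `L₁.sum L₂` from atom translations of the summands
(typically: `L₁` the ground language rendered by `ofDecidable`, `L₂` oracle predicates rendered
by `oracle`). [cite: Krajicek1995, Def. 9.1.1] -/
def sum {L₁ : FirstOrder.Language.{u, v}} {L₂ : FirstOrder.Language.{u, v}} (a₁ : PWAtom L₁) (a₂ : PWAtom L₂) :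
    PWAtom (L₁.sum L₂) :=
  fun _ R w => Sum.elim (fun R₁ => a₁ R₁ w) (fun R₂ => a₂ R₂ w) R

end PWAtom

/-- The relation `≤` of Buss's language is decidable on `ℕ`. [folklore] -/
instance decidableRelMapBoundedArith :
    ∀ ⦃l : ℕ⦄ (R : Language.boundedArith.Relations l) (w : Fin l → ℕ), Decidable (RelMap R w)
  | _, .le, w => inferInstanceAs (Decidable (w 0 ≤ w 1))

/-- The atom translation for Buss's language of bounded arithmetic: `⟨s ≤ t⟩` is the truth
constant of `val s ≤ val t` (Krajíček 1995, Def. 9.1.1 (a)). [cite: Krajicek1995, Def. 9.1.1] -/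
def bussAtom : PWAtom Language.boundedArith :=
  PWAtom.ofDecidable decidableRelMapBoundedArith

namespace Delta0Formula

variable {L : FirstOrder.Language.{u, v}} [L.IsOrdered] [L.Structure ℕ] {α : Type}

/-- The **Paris–Wilkie translation** `⟨φ⟩_(v, xs)` of a bounded formula `φ` at numerical values
`v` (free variables) and `xs` (outer bound variables): a propositional formula over the
variables `ℕ`, defined by recursion on `φ` (Paris–Wilkie 1985, §1; Krajíček 1995, Def. 9.1.1):
* `⟨⊥⟩ = ⊥`; `⟨s = t⟩ =` the truth constant of `val s = val t` (terms are evaluated in `ℕ`);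
* `⟨R(t̄)⟩ = atom R (val t̄)` (a truth constant for ground symbols, a propositional variable
  `p_{val t̄}` for an oracle symbol, see `PWAtom`);
* `⟨φ → ψ⟩ = ¬⟨φ⟩ ∨ ⟨ψ⟩`;
* `⟨(∀ x ≤ t) φ⟩ = ⋀_{m = 0}^{val t} ⟨φ⟩_(…, m)` and `⟨(∃ x ≤ t) φ⟩ = ⋁_{m = 0}^{val t} ⟨φ⟩_(…, m)`.
[cite: Krajicek1995, Def. 9.1.1] -/
def parisWilkie (atom : PWAtom L) :
    ∀ {n : ℕ}, Delta0Formula L α n → (α → ℕ) → (Fin n → ℕ) → PropForm ℕ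
  | _, falsum, _, _ => .const false
  | _, equal t₁ t₂, v, xs =>
      .const (decide (t₁.realize (Sum.elim v xs) = t₂.realize (Sum.elim v xs)))
  | _, rel R ts, v, xs => atom R fun i => (ts i).realize (Sum.elim v xs)
  | _, imp φ ψ, v, xs => (φ.parisWilkie atom v xs).impl (ψ.parisWilkie atom v xs)
  | _, ball t φ, v, xs => PropForm.conjs <|
      (List.range (t.realize (Sum.elim v xs) + 1)).map fun m =>
        φ.parisWilkie atom v (Fin.snoc xs m : Fin (_ + 1) → ℕ)
  | _, bex t φ, v, xs => PropForm.disjs <|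
      (List.range (t.realize (Sum.elim v xs) + 1)).map fun m =>
        φ.parisWilkie atom v (Fin.snoc xs m : Fin (_ + 1) → ℕ)

variable {n : ℕ}

/-- Unfolding of the translation of a bounded universal quantifier. [cite: Krajicek1995, Def. 9.1.1] -/
theorem parisWilkie_ball (atom : PWAtom L) (t : L.Term (α ⊕ Fin n))
    (φ : Delta0Formula L α (n + 1)) (v : α → ℕ) (xs : Fin n → ℕ) :
    (ball t φ).parisWilkie atom v xs = PropForm.conjs
      ((List.range (t.realize (Sum.elim v xs) + 1)).map fun m =>
        φ.parisWilkie atom v (Fin.snoc xs m : Fin (n + 1) → ℕ)) := rfl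

/-- Unfolding of the translation of a bounded existential quantifier. [cite: Krajicek1995, Def. 9.1.1] -/
theorem parisWilkie_bex (atom : PWAtom L) (t : L.Term (α ⊕ Fin n))
    (φ : Delta0Formula L α (n + 1)) (v : α → ℕ) (xs : Fin n → ℕ) :
    (bex t φ).parisWilkie atom v xs = PropForm.disjs
      ((List.range (t.realize (Sum.elim v xs) + 1)).map fun m =>
        φ.parisWilkie atom v (Fin.snoc xs m : Fin (n + 1) → ℕ)) := rfl

/-- **Semantics of the Paris–Wilkie translation.** If the truth assignment `σ` and the
`ℕ`-structure agree on atoms (`atom R m̄` is true under `σ` iff `R(m̄)` holds in `ℕ` — automatic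
for ground symbols, and *defining* the oracle from `σ` for oracle symbols), then `⟨φ⟩_(v, xs)`
is true under `σ` iff `ℕ ⊨ φ(v, xs)` (Krajíček 1995, §9.1, remark after Def. 9.1.1).
[cite: Krajicek1995, §9.1] -/
theorem eval_parisWilkie {atom : PWAtom L} {σ : ℕ → Bool}
    (hσ : ∀ ⦃l : ℕ⦄ (R : L.Relations l) (w : Fin l → ℕ), (atom R w).eval σ = true ↔ RelMap R w)
    (φ : Delta0Formula L α n) (v : α → ℕ) (xs : Fin n → ℕ) :
    (φ.parisWilkie atom v xs).eval σ = true ↔ φ.Realize v xs := by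
  induction φ with
  | falsum => simp [parisWilkie, Realize, PropForm.eval]
  | equal t₁ t₂ => simp [parisWilkie, Realize, PropForm.eval]
  | rel R ts => simp [parisWilkie, Realize, hσ]
  | imp φ ψ ihφ ihψ => simp [parisWilkie, Realize, ihφ, ihψ]
  | ball t φ ih => simp [parisWilkie, Realize, ih]
  | bex t φ ih => simp [parisWilkie, Realize, ih]

end Delta0Formula

/-! ## Buss's language: the translation is variable-free and expresses truth in `ℕ` -/

section Buss

open Delta0Formula

variable {α : Type} {n : ℕ}

/-- For Buss's `≤`, `bussAtom` renders `m₀ ≤ m₁` by its truth value. [cite: Krajicek1995, Def. 9.1.1] -/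
theorem eval_bussAtom (σ : ℕ → Bool) :
    ∀ ⦃l : ℕ⦄ (R : Language.boundedArith.Relations l) (w : Fin l → ℕ),
      (bussAtom R w).eval σ = true ↔ RelMap R w
  | _, .le, w => by simp [bussAtom, PWAtom.ofDecidable, PropForm.eval]

/-- On the (oracle-free) language of bounded arithmetic the Paris–Wilkie translation of
`φ(n̄)` is true under any assignment iff `ℕ ⊨ φ(n̄)` (Krajíček 1995, §9.1).
[cite: Krajicek1995, §9.1] -/
theorem eval_parisWilkie_bussAtom (σ : ℕ → Bool)
    (φ : Delta0Formula Language.boundedArith α n) (v : α → ℕ) (xs : Fin n → ℕ) :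
    (φ.parisWilkie bussAtom v xs).eval σ = true ↔ φ.toBoundedFormula.Realize v xs := by
  rw [realize_toBoundedFormula]
  exact eval_parisWilkie (eval_bussAtom σ) φ v xs

/-- Hence `⟨φ⟩_(n̄)` is a tautology iff `ℕ ⊨ φ(n̄)`: on the oracle-free language the
translation merely expresses the truth of the bounded sentence `φ(n̄)` (Krajíček 1995, §9.1;
the content of the Paris–Wilkie theorem lies in the relativized case). [cite: Krajicek1995, §9.1] -/
theorem isTautology_parisWilkie_iff (φ : Delta0Formula Language.boundedArith α n) (v : α → ℕ)
    (xs : Fin n → ℕ) :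
    (φ.parisWilkie bussAtom v xs).IsTautology ↔ φ.toBoundedFormula.Realize v xs :=
  ⟨fun h => (eval_parisWilkie_bussAtom (fun _ => true) φ v xs).1 (h _),
    fun h σ => (eval_parisWilkie_bussAtom σ φ v xs).2 h⟩

end Buss

end Literature.Computability.MetaComplexity
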